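import Summits.CriticalPhenomena.PercolationContinuityZ3.Theorems.PercNearOneGluingNoHeavyLowerTailThreePointProductFormPsiDefs
import Summits.CriticalPhenomena.PercolationContinuityZ3.Theorems.PercNearOneGluingNoHeavyLowerTailThreePointProductFormPsiCert1
import Summits.CriticalPhenomena.PercolationContinuityZ3.Theorems.PercNearOneGluingNoHeavyLowerTailThreePointProductFormPsiCert2
import Summits.CriticalPhenomena.PercolationContinuityZ3.Theorems.PercNearOneGluingNoHeavyLowerTailThreePointProductFormPsiCert3
import Summits.CriticalPhenomena.PercolationContinuityZ3.Theorems.PercNearOneGluingNoHeavyLowerTailThreePointProductFormPsiCert4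
import Summits.CriticalPhenomena.PercolationContinuityZ3.Theorems.PercNearOneGluingNoHeavyLowerTailThreePointProductFormLeakCone

/-!
# LEMMA ψ for the one-child boundary-star cycle: `ψ₂₃(m₋) ≤ (3/20)·t` for EVERY physical word
# (Sahi programme, box problem, prover prim-sahi-p2 gen 66)

Support file (`--supports stmt-CriticalPhenomena-4575`).  Standard axioms, no sorries, no named facts.  Memo
`run/shared/lean/prim/prim-sahi/FROM-prim-sahi-p2-gen66-KREIN-STRUCTURE.md` §4, §5d, `prim-sahi-p2/PROOF-E3.md` §76.

THE STATEMENT.  For the 12-state normal form of the AM-form series `A = #P1 + #P2 − 2·#bad` (`…ProductFormABPlus`) driven by PHYSICAL letters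
`(s,d)` (`0 ≤ s ± d`), the copy-basis column `m₋ = colM` (`…ProductFormKrein`) satisfies `ψ₂₃(m₋) ≤ (3/20)·t` on every state reached from `ω`
(`psi_le`; `ψ₂₃ = psi23 = 4x + 23y`).  This is lemma (ii) of the three-lemma reduction of the box theorem (memo §4): with LEMMA Λ (`leak_le`,
`…ProductFormLeakCone`) it bounds the linear part of the pair identity `A[u++w] = (81/64)tt′ − (135/112)(tΛ*′ + Λ*t′) + …`, `Λ* = Λ + (14/3)ψ₂₃(m₋) ≤ (7/15)t`,
from below by `(9/64)·t t′`.

THE PROOF.  The rational cone `K_ψ = inKP` of `…ProductFormPsiDefs` (6 linear + 4 second-order-cone constraints; a paraboloid vertex at the start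
state, which is fixed by the letter `d = 0`) contains `zP ω` (`inKP_omega`) and is mapped into itself by every physical letter (`inKP_AstepP`): the nine
constraint-preservation facts are the exact S-procedure certificates `cert_P*` of `…ProductFormPsiCert1–4` (semidefinite programming with facial
reduction at the vertex, rounded exactly; kit j344178/j344182/j344213/j344214/j344215; independent exact verifier `gen66/lab66/psiverify.py`); `L1` is elementary.  Induction over the word
(`inKP_brun`); the conjunct `G` of `inKP` is the claim (`psi23_colM_eq`).  [this work] (gen 66).
-/

namespace Summit.CriticalPhenomena.PercolationContinuityZ3.Theorems.ProductFormABPlus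

set_option maxHeartbeats 2000000 in
/-- ★ INVARIANCE: every physical letter maps the cone `K_ψ` into itself. [this work] -/
theorem inKP_AstepP (s d : ℚ) (z : Z4) (hp : 0 ≤ s + d) (hm : 0 ≤ s - d) (h : inKP z) : inKP (AstepP s d z) := by
  obtain ⟨h1, h2, h3, h4, h5, h6, hQV, hQS, hQW, hQU⟩ := h
  rcases eq_or_ne s 0 with hs0 | hs
  · -- s = 0 forces d = 0 and the image is the zero state
    have hd : d = 0 := by subst hs0; linarith
    subst hs0; subst hd
    unfold inKP AstepP
    norm_num
  have hPnn : 0 ≤ ((1:ℚ)*z.τ + (10:ℚ)*z.b) := by linarith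
  rcases eq_or_lt_of_le hPnn with hP0 | hPpos
  · -- degenerate face τ = b = 0: then b₋ = 0 and η = 0, the image is 0
    have ht : z.τ = 0 := by linarith
    have hb : z.b = 0 := by linarith
    have hbm : z.bm = 0 := by linarith
    have he2 : z.η * z.η ≤ 0 := by rw [hb] at hQV; linarith
    have he : z.η = 0 := by nlinarith [sq_nonneg z.η]
    unfold inKP AstepP
    simp only [ht, hb, hbm, he]
    norm_num
  -- generic case: the certificates
  have cL2 := cert_PL2 s d z.τ z.b z.bm z.η hp hm h1 h2 h3 h4 h5 h6 hQV hQS hQW hQU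
  have cL3 := cert_PL3 s d z.τ z.b z.bm z.η hp hm h1 h2 h3 h4 h5 h6 hQV hQS hQW hQU
  have cQWl := cert_PQWl s d z.τ z.b z.bm z.η hp hm h1 h2 h3 h4 h5 h6 hQV hQS hQW hQU
  have cQUl := cert_PQUl s d z.τ z.b z.bm z.η hp hm h1 h2 h3 h4 h5 h6 hQV hQS hQW hQU
  have cG := cert_PG s d z.τ z.b z.bm z.η hp hm h1 h2 h3 h4 h5 h6 hQV hQS hQW hQU
  have cQV := cert_PQV s d z.τ z.b z.bm z.η hp hm h1 h2 h3 h4 h5 h6 hQV hQS hQW hQU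
  have cQS := cert_PQS s d z.τ z.b z.bm z.η hp hm h1 h2 h3 h4 h5 h6 hQV hQS hQW hQU
  have cQW := cert_PQW s d z.τ z.b z.bm z.η hp hm h1 h2 h3 h4 h5 h6 hQV hQS hQW hQU
  have cQU := cert_PQU s d z.τ z.b z.bm z.η hp hm h1 h2 h3 h4 h5 h6 hQV hQS hQW hQU
  have h1' : 0 ≤ z.τ := by linarith
  have dL1 : 0 ≤ ((1:ℚ)*(s^2*(((3:ℚ)/4)*z.τ) + d^2*(((1:ℚ)/4)*z.τ))) := by nlinarith [mul_nonneg (sq_nonneg s) h1', mul_nonneg (sq_nonneg d) h1']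
  have dL2 : 0 ≤ ((1:ℚ)*(s^2*(((369:ℚ)/128)*z.b + ((-1:ℚ)/128)*z.bm) + (s*d)*((1:ℚ)*z.η) + d^2*(((3:ℚ)/1280)*z.τ + ((53:ℚ)/64)*z.b + ((-5:ℚ)/64)*z.bm))) := nonneg_of_cert hs hPpos cL2
  have dL3 : 0 ≤ (((1:ℚ)/4)*(s^2*(((369:ℚ)/128)*z.b + ((-1:ℚ)/128)*z.bm) + (s*d)*((1:ℚ)*z.η) + d^2*(((3:ℚ)/1280)*z.τ + ((53:ℚ)/64)*z.b + ((-5:ℚ)/64)*z.bm)) + (1:ℚ)*(s^2*(((1:ℚ)/128)*z.b + ((111:ℚ)/128)*z.bm) + (s*d)*((1:ℚ)*z.η) + d^2*(((19:ℚ)/1280)*z.τ + ((53:ℚ)/64)*z.b + ((-5:ℚ)/64)*z.bm))) := nonneg_of_cert hs hPpos cL3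
  have dQWl : 0 ≤ (((29:ℚ)/2)*(s^2*(((369:ℚ)/128)*z.b + ((-1:ℚ)/128)*z.bm) + (s*d)*((1:ℚ)*z.η) + d^2*(((3:ℚ)/1280)*z.τ + ((53:ℚ)/64)*z.b + ((-5:ℚ)/64)*z.bm)) + (-1:ℚ)*(s^2*(((1:ℚ)/128)*z.b + ((111:ℚ)/128)*z.bm) + (s*d)*((1:ℚ)*z.η) + d^2*(((19:ℚ)/1280)*z.τ + ((53:ℚ)/64)*z.b + ((-5:ℚ)/64)*z.bm))) := nonneg_of_cert hs hPpos cQWl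
  have dQUl : 0 ≤ (((41:ℚ)/2000)*(s^2*(((3:ℚ)/4)*z.τ) + d^2*(((1:ℚ)/4)*z.τ)) + (3:ℚ)*(s^2*(((369:ℚ)/128)*z.b + ((-1:ℚ)/128)*z.bm) + (s*d)*((1:ℚ)*z.η) + d^2*(((3:ℚ)/1280)*z.τ + ((53:ℚ)/64)*z.b + ((-5:ℚ)/64)*z.bm)) + (-1:ℚ)*(s^2*(((1:ℚ)/128)*z.b + ((111:ℚ)/128)*z.bm) + (s*d)*((1:ℚ)*z.η) + d^2*(((19:ℚ)/1280)*z.τ + ((53:ℚ)/64)*z.b + ((-5:ℚ)/64)*z.bm))) := nonneg_of_cert hs hPpos cQUl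
  have dG : 0 ≤ (((3:ℚ)/20)*(s^2*(((3:ℚ)/4)*z.τ) + d^2*(((1:ℚ)/4)*z.τ)) + ((39:ℚ)/4)*(s^2*(((369:ℚ)/128)*z.b + ((-1:ℚ)/128)*z.bm) + (s*d)*((1:ℚ)*z.η) + d^2*(((3:ℚ)/1280)*z.τ + ((53:ℚ)/64)*z.b + ((-5:ℚ)/64)*z.bm)) + ((-23:ℚ)/4)*(s^2*(((1:ℚ)/128)*z.b + ((111:ℚ)/128)*z.bm) + (s*d)*((1:ℚ)*z.η) + d^2*(((19:ℚ)/1280)*z.τ + ((53:ℚ)/64)*z.b + ((-5:ℚ)/64)*z.bm))) := nonneg_of_cert hs hPpos cG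
  unfold inKP
  exact ⟨dL1, dL2, dL3, dQWl, dQUl, dG, cQV, cQS, cQW, cQU⟩

/-- The start state is in the cone: `zP ω ∈ K_ψ` (it is the vertex). [this work] -/
theorem inKP_omega : inKP (zP omegaA) := by
  rw [zP_omegaA]
  unfold inKP
  norm_num

/-- Every state reached from `ω` by a physical word lies in `K_ψ`. [this work] -/
theorem inKP_brun : ∀ (w : List (ℚ × ℚ)), (∀ θ ∈ w, 0 ≤ θ.1 + θ.2 ∧ 0 ≤ θ.1 - θ.2) → inKP (zP (brunA w omegaA))
  | [], _ => inKP_omega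
  | θ :: u, hw => by
    have h := hw θ (by simp)
    show inKP (zP (bstepA θ.1 θ.2 (brunA u omegaA)))
    rw [zP_bstepA]
    exact inKP_AstepP θ.1 θ.2 _ h.1 h.2 (inKP_brun u (fun θ' hθ' => hw θ' (by simp [hθ'])))

/-- ★★ LEMMA ψ (gen 66 memo §4(ii)): for every physical word, `ψ₂₃(m₋) ≤ (3/20)·t`:
`psi23 (colM (brunA w ω)) ≤ (3/20) · (brunA w ω).t`. [this work] -/
theorem psi_le (w : List (ℚ × ℚ)) (hw : ∀ θ ∈ w, 0 ≤ θ.1 + θ.2 ∧ 0 ≤ θ.1 - θ.2) :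
    psi23 (colM (brunA w omegaA)) ≤ (3/20) * (brunA w omegaA).t := by
  have hK := inKP_brun w hw
  obtain ⟨_, _, _, _, _, hG, _, _, _, _⟩ := hK
  have hτ : (zP (brunA w omegaA)).τ = (brunA w omegaA).t := rfl
  rw [psi23_colM_eq]
  rw [hτ] at hG
  linarith

end Summit.CriticalPhenomena.PercolationContinuityZ3.Theorems.ProductFormABPlus
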